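import Literature.NumberTheory.EllipticCurves.QuadOrderPicardRingClassGroup
import Literature.NumberTheory.QuadraticFields.RingClassForms
import Mathlib.RingTheory.ClassGroup.ExtendedHom
import HarnessLib

/-!
# The form class group `C(D) = ClassGroup (QO Δ)` IS the Picard group `Pic(𝒪_c) = ClassGroup (quadOrder K c)`,
# `D = c²d_K`, with the FORMULA on form classes (Cox, Thm. 7.7 (ii) with Prop. 7.22)

Topic `NumberTheory/EllipticCurves` (sequel of `QuadOrderPicardRingClassGroup.lean` and of
`QuadraticFields/RingClassForms.lean`). THEOREMS ONLY: no definition, no named fact, no `sorry`, no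
instance, no notation (D-0026; net Literature debt 0).

## Why

The tree carries the ring class group of the order of conductor `c` in an imaginary quadratic field `K`
in three currencies:

* the FORM currency of the Hallgren/CSIDH series and of the Heegner-point files: the abstract order
  `O_D = OrderCl.QO Δ` (`Δ : NegDiscr`, `D = Δ.D = c²d_K`), its class group `ClassGroup (QO Δ)` and the classes
  of forms `OrderCl.classOf' Δ ⟨a, b, c'⟩ = [𝔞_{(a,b,c')}]`, `𝔞 = fIdeal Δ q = (a, ω_D − k(q)) = [a, (−b + √D)/2]`
  (`HallgrenClassGroupOrder`); this is where singular moduli live (`SingularModuliClassGroupAction*`: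
  `classJ Δ`, the Hasse translation law);
* the PICARD currency of the Gross-points files: `ClassGroup (quadOrder K c)`, `quadOrder K c = ℤ + c𝓞_K ⊆ K`
  (`GrossPoints`, `QuadOrderPicard*`), where the restriction maps `picRes` and the Artin isomorphisms with
  Frobenius normalisation live (`QuadOrderPicardRingClassField`);
* the IDEAL currency `RingClass.RingClassGroup K c = I_K(c)/P_{K,ℤ}(c)` (`QuadraticFields/RingClassGroup*`).

The second and third are identified WITH A FORMULA by `QuadOrderTower.picardRingClassEquiv`
(`picardRingClassEquiv_mk`: `[𝔞] ↦ [(a𝔞)𝓞_K]`); the first and third by `RingClassForms`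
(`q ↦ [𝔞_q 𝓞_K]`, class-invariant, injective, onto — but as a map on forms, not as a group isomorphism);
the first and second only abstractly (`CMTypeLattice.nonempty_mulEquiv_classGroup_QO_ringClassGroup'`).
This file supplies the missing square: a group isomorphism `ClassGroup (QO Δ) ≃* ClassGroup (quadOrder K c)`
TOGETHER WITH its value on form classes, and the value of `picardRingClassEquiv` after it.

## Contents (Cox, Thm. 7.7 (ii): «the map sending `f(x, y)` to `[a, (−b + √D)/2]` induces a bijection
## `C(D) ≃ C(𝒪)`»; Prop. 7.22: «`C(𝒪) ≃ I(𝒪, f)/P(𝒪, f) ≃ I_K(f)/P_{K,ℤ}(f)`», `𝔞 ↦ 𝔞𝒪_K`)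

Data as in `RingClassOrder`/`RingClassForms`: an integral basis `b = (1, ω)` of `𝓞_K`, `ω² = m + tω`
(`d_K = t² + 4m`), the conductor `c ≥ 1`, `Δ.D = c²(t² + 4m)`, `2s = Δ.D − ct`, and the embedding
`ι : O_D →+* 𝓞_K`, `ω_D ↦ cω + s` (`RingClass.exists_ringHom`).

* §1 `algebraMap_emb_mem_quadOrder`, `exists_emb_eq_of_mem_quadOrder`, **`exists_ringHom_quadOrder`** — `ι`
  co-restricts to a ring ISOMORPHISM `φ : O_D → 𝒪_c = quadOrder K c` (`(φ z : K) = ι z`; Lemma 7.2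
  «`𝒪 = ℤ + f𝒪_K`»).
* §2 **`picardRingClassEquiv_mk_of_coe_eq_map_fIdeal`** — for a form `q` with `gcd(a_q, c) = 1` and the
  invertible `𝒪_c`-ideal `𝔟_q = φ(𝔞_q) = (a, φ(ω_D − k(q)))`: `picardRingClassEquiv hK c [𝔟_q] = [𝔞_q 𝓞_K]`, the
  class of `RingClassForms` (Prop. 7.20/7.22: `𝔟_q` is integral, prime to `c`, and `𝓞_K · 𝔟_q = 𝔞_q𝓞_K`).
* §3 **`exists_formClassEquiv`** — THE BRIDGE: there is `e : ClassGroup (QO Δ) ≃* ClassGroup (quadOrder K c)`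
  with `e [𝔞] = [φ(𝔞)]` for every invertible ideal `𝔞 ⊆ O_D`; in particular
  `e (classOf' Δ q) = ClassGroup.mk K u` whenever `(u : FractionalIdeal) = φ(fIdeal Δ q)`
  (**`exists_formClassEquiv_classOf'`**), and then `picardRingClassEquiv hK c (e (classOf' Δ q)) = [𝔞_q𝓞_K]`
  for `gcd(a_q, c) = 1`; **`exists_formClassEquiv_of_discr_eq`** — the same from `K`, `c` and `Δ.D = c²d_K`
  alone (basis, shift, `ι`, `φ`, `e` all produced); **`formClassEquiv_unique`** — `e` is determined by its
  values on form classes.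
  Construction: Mathlib's `ClassGroup.extendedHom` along `φ` (`extendedHom_mk`: `[I] ↦ [I𝒪_c]`), injective by
  `RingClassForms.properEquiv_of_mk_eq` through §2, bijective by counting
  (`|C(O_D)| = h(D) = |Pic(𝒪_c)|`: `CMTypeLattice.natCard_classGroup_QO_eq_classNumber'`,
  `natCard_classGroup_quadOrder_eq_classNumber`).

NOT here (waits for the consumer's normalisation, planner D829 (2)): the prime case
`e (classOf' Δ ⟨ℓ, β, ·⟩) ↦ RingClassField.primeClass c v`, and the `picRes`-compatibility square.

## References

* [Cox2013] D. A. Cox, *Primes of the Form x² + ny²*, 2nd ed., Wiley 2013, §7.A Lemma 7.2 (p. 133),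
  §7.B Thm. 7.7 (ii) (pp. 137–138), §7.C Lemma 7.18, Prop. 7.20, Prop. 7.22 (pp. 143–146).

## Mathlib / tree search

Tree, BY NAME: `quadOrder`, `mem_quadOrder_iff` (`GrossPoints`); `fracIdealLattice`, `mem_fracIdealLattice_iff`
(`GrossPointsPicardAction`); `QuadOrderTower.picardRingClassEquiv`, `picardRingClassEquiv_mk`,
`natCard_classGroup_quadOrder_eq_classNumber` (`QuadOrderPicardRingClassGroup`); `QuadOrderTower.finite_classGroup`
(`QuadOrderPicardFinite`); `RingClass.emb_apply`, `emb_injective`, `intCast_mem_range`, `natCast_mul_mem_range`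
(`RingClassOrder`); `RingClass.mk0_map_fIdeal_mem`, `map_fIdeal_ne_bot`, `natAbs_mem_map_fIdeal`,
`properEquiv_of_mk_eq` (`RingClassForms`); `CMTypeLattice.natCard_classGroup_QO_eq_classNumber'`,
`existsUnique_isReduced_classOf'_eq` (`CMLatticeHallgrenOrderClassGroup`); `OrderCl.classOf'_eq`, `val_fUnit`,
`fIdeal`, `classOf'_reduce` (`HallgrenClassGroupOrder`); `Reduction.reduce_eq_iff_properEquiv`;
`BinQF.exists_properEquiv_isPosPrim_isCoprime_a`; `Quadratic.discr_eq_sq_add_four_mul`,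
`repr_intCast_add_intCast_mul_zero/one`. `rg 'quadOrder' | rg "classOf'|fIdeal"` over `Literature/`: 0 files —
no prior statement relating form classes to `ClassGroup (quadOrder K c)`. Mathlib: `ClassGroup.extendedHom`,
`ClassGroup.extendedHom_mk`, `FractionalIdeal.extendedHom_coeIdeal_eq_map`, `ClassGroup.mk_canonicalEquiv`,
`FractionalIdeal.canonicalEquiv_coeIdeal`, `Module.isTorsionFree_iff_algebraMap_injective`,
`Function.Injective.bijective_of_nat_card_le`, `MulEquiv.ofBijective`, `RingHom.codRestrict`, `Ideal.map_span`,
`Ideal.mem_span_pair`, `Submodule.mul_le`, `Submodule.mul_mem_mul`.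
-/

noncomputable section

open scoped nonZeroDivisors Pointwise QuadraticAlgebra
open NumberField Module QuadraticAlgebra
open Literature.Computability.Cryptography.Hallgren2005
open Literature.Computability.Cryptography.Hallgren2005.OrderCl
open Literature.Computability.Cryptography.Hallgren2005.Reduction
open Literature.Computability.Cryptography.Hallgren2005.FormComposition (mOf kOf)
open Literature.NumberTheory.QuadraticFields Literature.NumberTheory.QuadraticFields.RingClass
open Literature.NumberTheory.QuadraticFields.Quadratic Literature.NumberTheory.QuadraticFields.Quadratic.BinQF
open Literature.NumberTheory.ComplexMultiplication

namespace Literature.NumberTheory.EllipticCurves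

namespace QuadOrderTower

variable {K : Type} [Field K] [NumberField K]
variable (b : Basis (Fin 2) ℤ (𝓞 K)) (hb : b 0 = 1) {t m : ℤ}
  (hω : b 1 * b 1 = (m : 𝓞 K) + (t : 𝓞 K) * b 1)
variable {c : ℕ} {Δ : NegDiscr} {s : ℤ}
  (hD : Δ.D = (c : ℤ) ^ 2 * (t ^ 2 + 4 * m)) (hs : 2 * s = Δ.D - c * t)
variable (ι : QO Δ →+* 𝓞 K) (hι : ι ω = (c : 𝓞 K) * b 1 + (s : 𝓞 K))

/-! ### §1 `ι : O_D → 𝓞_K` co-restricts to a ring isomorphism `O_D ≃ 𝒪_c = quadOrder K c` -/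

omit [NumberField K] in
include hι in
/-- `ι(O_D) ⊆ 𝒪_c = ℤ + c𝓞_K`: `ι(x + yω_D) = (x + ys) + c·(yω)`. [cite: Cox2013, §7.A Lemma 7.2 («𝒪 = ℤ + f𝒪_K»), p. 133] -/
theorem algebraMap_emb_mem_quadOrder (z : QO Δ) : algebraMap (𝓞 K) K (ι z) ∈ quadOrder K c := by
  rw [emb_apply b ι hι z, mem_quadOrder_iff]
  refine ⟨z.re + z.im * s, (z.im : 𝓞 K) * b 1, ?_⟩
  simp only [map_add, map_mul, map_intCast]
  push_cast
  ring

omit [NumberField K] in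
include hb hι in
/-- `𝒪_c ⊆ ι(O_D)`: an element `a + c·y` (`a ∈ ℤ`, `y ∈ 𝓞_K`) is `ι` of something (`ℤ ⊆ ι(O_D)` and
`c𝓞_K ⊆ ι(O_D)`). [cite: Cox2013, §7.A Lemma 7.2 («𝒪 = ℤ + f𝒪_K»), p. 133] -/
theorem exists_emb_eq_of_mem_quadOrder {x : K} (hx : x ∈ quadOrder K c) :
    ∃ z : QO Δ, algebraMap (𝓞 K) K (ι z) = x := by
  obtain ⟨a, y, rfl⟩ := mem_quadOrder_iff.1 hx
  obtain ⟨z₁, hz₁⟩ := intCast_mem_range ι a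
  obtain ⟨z₂, hz₂⟩ := natCast_mul_mem_range b hb ι hι y
  exact ⟨z₁ + z₂, by rw [map_add, hz₁, hz₂, map_add, map_intCast, map_mul, map_natCast]⟩

omit [NumberField K] in
include hb hι in
/-- A ring homomorphism `φ : O_D → 𝒪_c` with `(φ z : K) = ι z` is injective (`c ≠ 0`). [cite: Cox2013, §7.A Lemma 7.2, p. 133] -/
theorem ringHom_quadOrder_injective (hc : c ≠ 0) (φ : QO Δ →+* quadOrder K c)
    (hφ : ∀ z : QO Δ, ((φ z : quadOrder K c) : K) = algebraMap (𝓞 K) K (ι z)) : Function.Injective φ :=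
  fun z w h => emb_injective b hb ι hι hc (FaithfulSMul.algebraMap_injective (𝓞 K) K (by rw [← hφ, ← hφ, h]))

omit [NumberField K] in
include hb hι in
/-- **`O_D ≅ 𝒪_c` as rings, compatibly with `ι`**: there is a (unique, by the formula) ring homomorphism
`φ : O_D → quadOrder K c` with `(φ z : K) = ι z`, and it is BIJECTIVE (`ι` is injective for `c ≠ 0`,
`RingClass.emb_injective`; onto by the previous lemma). [cite: Cox2013, §7.A Lemma 7.2 and (7.2)–(7.3), p. 133] -/
theorem exists_ringHom_quadOrder (hc : c ≠ 0) :
    ∃ φ : QO Δ →+* quadOrder K c, Function.Bijective φ ∧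
      ∀ z : QO Δ, ((φ z : quadOrder K c) : K) = algebraMap (𝓞 K) K (ι z) := by
  let φ : QO Δ →+* quadOrder K c :=
    ((algebraMap (𝓞 K) K).comp ι).codRestrict (quadOrder K c) (fun z => algebraMap_emb_mem_quadOrder b ι hι z)
  have hφ : ∀ z : QO Δ, ((φ z : quadOrder K c) : K) = algebraMap (𝓞 K) K (ι z) := fun z => rfl
  refine ⟨φ, ⟨ringHom_quadOrder_injective b hb ι hι hc φ hφ, fun x => ?_⟩, hφ⟩
  · obtain ⟨z, hz⟩ := exists_emb_eq_of_mem_quadOrder b hb ι hι x.2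
    exact ⟨z, Subtype.ext hz⟩

/-! ### §2 The `𝒪_c`-ideal `𝔟_q = φ(𝔞_q)` of a form and its class in `I_K(c)/P_{K,ℤ}(c)` -/

omit [NumberField K] in
/-- `φ(𝔞_q)` is generated by `a_q` and `φ(ω_D − k(q))`. [cite: Cox2013, §7.B Thm. 7.7 (the ideal [a, (−b+√D)/2]), p. 137] -/
theorem map_fIdeal_eq_span (φ : QO Δ →+* quadOrder K c) (q : BinQF) :
    (fIdeal Δ q).map φ = Ideal.span {(q.a : quadOrder K c), φ (ω - (kOf Δ.D q : QO Δ))} := by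
  rw [fIdeal, Ideal.map_span, Set.image_pair, map_intCast]

omit [NumberField K] in
/-- `a_q ∈ φ(𝔞_q)`. [cite: Cox2013, §7.B Thm. 7.7, p. 137] -/
theorem intCast_mem_map_fIdeal (φ : QO Δ →+* quadOrder K c) (q : BinQF) :
    ((q.a : ℤ) : quadOrder K c) ∈ (fIdeal Δ q).map φ := by
  rw [map_fIdeal_eq_span]
  exact Ideal.subset_span (by simp)

omit [NumberField K] in
/-- Elements of `𝒪_c` are integers of `K` (bookkeeping: `𝒪_c ⊆ 𝓞_K`). [cite: Cox2013, §7.A Lemma 7.2, p. 133] -/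
theorem exists_algebraMap_eq_of_mem_quadOrder {x : K} (hx : x ∈ quadOrder K c) :
    ∃ y : 𝓞 K, algebraMap (𝓞 K) K y = x := by
  obtain ⟨a, y, rfl⟩ := mem_quadOrder_iff.1 hx
  exact ⟨(a : 𝓞 K) + (c : 𝓞 K) * y, by simp only [map_add, map_mul, map_intCast, map_natCast]⟩

omit [NumberField K] in
/-- **The lattice identity `𝓞_K · 𝔟_q = 𝔞_q𝓞_K`** (as `ℤ`-submodules of `K`): the `𝓞_K`-module generated by the
`𝒪_c`-ideal `φ(𝔞_q)` is the `𝓞_K`-ideal `ι(𝔞_q)𝓞_K` of `RingClassForms` («`𝔞 ↦ 𝔞𝒪_K`»).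
[cite: Cox2013, §7.C Prop. 7.20 and Prop. 7.22 («𝔞 ↦ 𝔞𝒪_K»), pp. 144–146] -/
theorem map_restrictScalars_map_fIdeal_eq (φ : QO Δ →+* quadOrder K c)
    (hφ : ∀ z : QO Δ, ((φ z : quadOrder K c) : K) = algebraMap (𝓞 K) K (ι z)) (q : BinQF)
    (u : (FractionalIdeal (quadOrder K c)⁰ K)ˣ)
    (hu : (u : FractionalIdeal (quadOrder K c)⁰ K) = (((fIdeal Δ q).map φ : Ideal (quadOrder K c)) :
      FractionalIdeal (quadOrder K c)⁰ K)) :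
    (((fIdeal Δ q).map ι).restrictScalars ℤ).map ((Algebra.linearMap (𝓞 K) K).restrictScalars ℤ) =
      Subalgebra.toSubmodule (integralClosure ℤ K) * fracIdealLattice c (u : FractionalIdeal (quadOrder K c)⁰ K) := by
  -- membership in the lattice of `u`: images of elements of the ideal `φ(𝔞_q)`
  have hmemu : ∀ x : K, x ∈ fracIdealLattice c (u : FractionalIdeal (quadOrder K c)⁰ K) ↔
      ∃ y ∈ (fIdeal Δ q).map φ, (y : K) = x := fun x => by
    rw [mem_fracIdealLattice_iff, hu, FractionalIdeal.mem_coeIdeal]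
    rfl
  have hgen : ∀ z : QO Δ, z ∈ fIdeal Δ q → algebraMap (𝓞 K) K (ι z) ∈
      fracIdealLattice c (u : FractionalIdeal (quadOrder K c)⁰ K) := fun z hz =>
    (hmemu _).2 ⟨φ z, Ideal.mem_map_of_mem _ hz, hφ z⟩
  have hint : ∀ y : 𝓞 K, algebraMap (𝓞 K) K y ∈ Subalgebra.toSubmodule (integralClosure ℤ K) := fun y =>
    (Subalgebra.mem_toSubmodule _).2 y.2
  apply le_antisymm
  · intro x hx
    obtain ⟨y, hy, rfl⟩ := Submodule.mem_map.1 hx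
    replace hy : y ∈ (fIdeal Δ q).map ι := hy
    rw [fIdeal, Ideal.map_span, Set.image_pair] at hy
    obtain ⟨r, r', rfl⟩ := Ideal.mem_span_pair.1 hy
    simp only [LinearMap.coe_restrictScalars, Algebra.linearMap_apply, map_add, map_mul]
    refine Submodule.add_mem _ (Submodule.mul_mem_mul (hint r) (hgen _ ?_))
      (Submodule.mul_mem_mul (hint r') (hgen _ ?_))
    · exact Ideal.subset_span (by simp)
    · exact Ideal.subset_span (by simp)
  · rw [Submodule.mul_le]
    intro y hy x hx
    obtain ⟨w, hw, rfl⟩ := (hmemu x).1 hx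
    rw [map_fIdeal_eq_span] at hw
    obtain ⟨r, r', rfl⟩ := Ideal.mem_span_pair.1 hw
    obtain ⟨y', rfl⟩ : ∃ y' : 𝓞 K, algebraMap (𝓞 K) K y' = y := by
      rw [Subalgebra.mem_toSubmodule, mem_integralClosure_iff] at hy
      exact ⟨⟨y, hy⟩, rfl⟩
    obtain ⟨ρ, hρ⟩ := exists_algebraMap_eq_of_mem_quadOrder (c := c) (r : quadOrder K c).2
    obtain ⟨ρ', hρ'⟩ := exists_algebraMap_eq_of_mem_quadOrder (c := c) (r' : quadOrder K c).2
    refine Submodule.mem_map.2 ⟨y' * (ρ * ι (q.a : QO Δ) + ρ' * ι (ω - (kOf Δ.D q : QO Δ))), ?_, ?_⟩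
    · change _ ∈ (fIdeal Δ q).map ι
      refine Ideal.mul_mem_left _ _ (Submodule.add_mem _ (Ideal.mul_mem_left _ _ (Ideal.mem_map_of_mem _ ?_))
        (Ideal.mul_mem_left _ _ (Ideal.mem_map_of_mem _ ?_)))
      · exact Ideal.subset_span (by simp)
      · exact Ideal.subset_span (by simp)
    · have h1 : algebraMap (𝓞 K) K (ι (q.a : QO Δ)) = (q.a : K) := by rw [map_intCast, map_intCast]
      simp only [LinearMap.coe_restrictScalars, Algebra.linearMap_apply, map_add, map_mul, hρ, hρ', h1]
      have hx : ((r * (q.a : quadOrder K c) + r' * φ (ω - (kOf Δ.D q : QO Δ)) : quadOrder K c) : K) =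
          (r : K) * (q.a : K) + (r' : K) * algebraMap (𝓞 K) K (ι (ω - (kOf Δ.D q : QO Δ))) := by
        rw [← hφ]; push_cast; ring
      rw [hx]

omit [NumberField K] in
/-- **`𝔟_q = φ(𝔞_q)` is integral**: its lattice lies in `𝒪_c`. [cite: Cox2013, §7.C Prop. 7.22 (proof), p. 145] -/
theorem fracIdealLattice_le_of_coe_eq_map_fIdeal (φ : QO Δ →+* quadOrder K c) (q : BinQF)
    (u : (FractionalIdeal (quadOrder K c)⁰ K)ˣ)
    (hu : (u : FractionalIdeal (quadOrder K c)⁰ K) = (((fIdeal Δ q).map φ : Ideal (quadOrder K c)) :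
      FractionalIdeal (quadOrder K c)⁰ K)) :
    fracIdealLattice c (u : FractionalIdeal (quadOrder K c)⁰ K) ≤ Subalgebra.toSubmodule (quadOrder K c) := by
  intro x hx
  rw [mem_fracIdealLattice_iff, hu, FractionalIdeal.mem_coeIdeal] at hx
  obtain ⟨y, -, rfl⟩ := hx
  exact (Subalgebra.mem_toSubmodule _).2 y.2

omit [NumberField K] in
/-- **`𝔟_q = φ(𝔞_q)` is prime to the conductor when `gcd(a_q, c) = 1`**: `𝔟_q + c𝒪_c = 𝒪_c` (as lattices),
since `a_q ∈ 𝔟_q` (Cox, Lemma 7.18: an `𝒪`-ideal is prime to `f` iff its norm is).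
[cite: Cox2013, §7.C Lemma 7.18 and Prop. 7.20, pp. 143–144] -/
theorem fracIdealLattice_sup_eq_of_coe_eq_map_fIdeal (φ : QO Δ →+* quadOrder K c) {q : BinQF}
    (hqa : IsCoprime q.a (c : ℤ)) (u : (FractionalIdeal (quadOrder K c)⁰ K)ˣ)
    (hu : (u : FractionalIdeal (quadOrder K c)⁰ K) = (((fIdeal Δ q).map φ : Ideal (quadOrder K c)) :
      FractionalIdeal (quadOrder K c)⁰ K)) :
    fracIdealLattice c (u : FractionalIdeal (quadOrder K c)⁰ K) ⊔ (c : K) • Subalgebra.toSubmodule (quadOrder K c) =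
      Subalgebra.toSubmodule (quadOrder K c) := by
  apply le_antisymm
  · refine sup_le (fracIdealLattice_le_of_coe_eq_map_fIdeal φ q u hu) ?_
    intro x hx
    obtain ⟨y, hy, rfl⟩ := (Submodule.mem_smul_pointwise_iff_exists _ _ _).1 hx
    rw [Subalgebra.mem_toSubmodule] at hy ⊢
    rw [smul_eq_mul]
    exact Subalgebra.mul_mem _ (by exact_mod_cast Subalgebra.natCast_mem (quadOrder K c) c) hy
  · intro x hx
    rw [Subalgebra.mem_toSubmodule] at hx
    obtain ⟨u₀, v₀, huv⟩ := hqa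
    -- `x = u₀ · (a_q x) + c · (v₀ x)` with `a_q x ∈ 𝔟_q` and `v₀ x ∈ 𝒪_c`
    have hax : (q.a : K) * x ∈ fracIdealLattice c (u : FractionalIdeal (quadOrder K c)⁰ K) := by
      rw [mem_fracIdealLattice_iff, hu, FractionalIdeal.mem_coeIdeal]
      refine ⟨(q.a : quadOrder K c) * ⟨x, hx⟩, Ideal.mul_mem_right _ _ (intCast_mem_map_fIdeal φ q), ?_⟩
      push_cast
      rfl
    have h1 : x = u₀ • ((q.a : K) * x) + (c : K) • ((v₀ : K) * x) := by
      rw [zsmul_eq_mul, smul_eq_mul]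
      have : (u₀ : K) * (q.a : K) + (v₀ : K) * (c : K) = 1 := by
        have h := congrArg (Int.cast : ℤ → K) huv
        push_cast at h
        exact h
      linear_combination (-x) * this
    rw [h1]
    refine Submodule.add_mem_sup (Submodule.smul_mem _ u₀ hax) (Submodule.smul_mem_pointwise_smul _ _ _ ?_)
    rw [Subalgebra.mem_toSubmodule]
    exact Subalgebra.mul_mem _ (by exact_mod_cast Subalgebra.intCast_mem (quadOrder K c) v₀) hx

/-- **`picardRingClassEquiv [𝔟_q] = [𝔞_q𝓞_K]`** for a primitive positive-definite form `q` of discriminant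
`D = c²d_K` with `gcd(a_q, c) = 1`: Cox's isomorphism `Pic(𝒪_c) ≃ I_K(c)/P_{K,ℤ}(c)`, `[𝔞] ↦ [𝔞𝒪_K]`
(`QuadOrderTower.picardRingClassEquiv`, pinned by `picardRingClassEquiv_mk`) sends the class of the
`𝒪_c`-ideal `𝔟_q = φ(𝔞_q) = (a, (−b + c√d_K)/2)` to the class `[𝔞_q𝓞_K]` of `RingClassForms`
(`mk0_map_fIdeal_mem`). [cite: Cox2013, §7.C Prop. 7.22, pp. 145–146] [cite: Cox2013, §7.B Thm. 7.7 (ii), p. 137] -/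
theorem picardRingClassEquiv_mk_of_coe_eq_map_fIdeal (hK : IsImaginaryQuadratic K) [NeZero c]
    (φ : QO Δ →+* quadOrder K c) (hφ : ∀ z : QO Δ, ((φ z : quadOrder K c) : K) = algebraMap (𝓞 K) K (ι z))
    {q : BinQF} (hq : q.IsPosPrim Δ.D) (hqa : IsCoprime q.a (c : ℤ))
    (u : (FractionalIdeal (quadOrder K c)⁰ K)ˣ)
    (hu : (u : FractionalIdeal (quadOrder K c)⁰ K) = (((fIdeal Δ q).map φ : Ideal (quadOrder K c)) :
      FractionalIdeal (quadOrder K c)⁰ K)) :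
    picardRingClassEquiv hK c (ClassGroup.mk K u) =
      (QuotientGroup.mk ⟨_, mk0_map_fIdeal_mem ι hq hqa⟩ : RingClassGroup K c) := by
  refine picardRingClassEquiv_mk hK c u one_ne_zero _ (map_fIdeal_ne_bot ι hq) (mk0_map_fIdeal_mem ι hq hqa)
    ?_ ?_ ?_
  · rw [one_smul]
    exact fracIdealLattice_le_of_coe_eq_map_fIdeal φ q u hu
  · rw [one_smul]
    exact fracIdealLattice_sup_eq_of_coe_eq_map_fIdeal φ hqa u hu
  · rw [one_smul]
    exact map_restrictScalars_map_fIdeal_eq ι φ hφ q u hu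

/-! ### §3 THE BRIDGE `e : C(O_D) ≃* Pic(𝒪_c)`, `[𝔞] ↦ [φ(𝔞)]` -/

/-- **`ClassGroup.extendedHom` on the class of an invertible INTEGRAL ideal, read in any field of fractions
`L` of the bigger ring**: `[𝔞] ↦ [𝔞B]`, i.e. the image of `[I]`, `(I : FractionalIdeal) = 𝔞`, is
`ClassGroup.mk L u` for a unit `u` with `(u : FractionalIdeal B⁰ L) = 𝔞B` (Mathlib's `extendedHom_mk` over
`FractionRing B`, transported by `canonicalEquiv`; Cox's «`𝔞 ↦ 𝔞𝒪_K` induces `C(𝒪) → C(𝒪_K)`» for a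
general extension of domains). [cite: Cox2013, §7.A («C(𝒪) = I(𝒪)/P(𝒪)») and §7.D (7.25) («[𝔞] ↦ [𝔞𝒪_K]»), pp. 136, 146] -/
theorem exists_extendedHom_mk_eq_mk {A B L : Type*} [CommRing A] [IsDomain A] [CommRing B] [IsDomain B]
    [Algebra A B] [Module.IsTorsionFree A B] [Field L] [Algebra B L] [IsFractionRing B L]
    (I : (FractionalIdeal A⁰ (FractionRing A))ˣ) (I₀ : Ideal A)
    (hI : (I : FractionalIdeal A⁰ (FractionRing A)) = (I₀ : FractionalIdeal A⁰ (FractionRing A))) :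
    ∃ u : (FractionalIdeal B⁰ L)ˣ,
      (u : FractionalIdeal B⁰ L) = ((I₀.map (algebraMap A B) : Ideal B) : FractionalIdeal B⁰ L) ∧
      ClassGroup.extendedHom A B (ClassGroup.mk (FractionRing A) I) = ClassGroup.mk L u := by
  refine ⟨Units.map ↑(FractionalIdeal.canonicalEquiv B⁰ (FractionRing B) L)
    (Units.map (FractionalIdeal.extendedHom (FractionRing B) B).toMonoidHom I), ?_, ?_⟩
  · simp only [Units.coe_map, MonoidHom.coe_coe, RingHom.toMonoidHom_eq_coe, hI,
      FractionalIdeal.extendedHom_coeIdeal_eq_map, FractionalIdeal.canonicalEquiv_coeIdeal]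
  · rw [ClassGroup.mk_canonicalEquiv, ClassGroup.extendedHom_mk]

include hb hω in
/-- `d_K = t² + 4m` for the basis `(1, ω)`, `ω² = m + tω` (bookkeeping). [cite: Cox2013, §7.A (7.3), p. 133] -/
theorem discr_eq_of_basis : NumberField.discr K = t ^ 2 + 4 * m := by
  rw [discr_eq_sq_add_four_mul b hb, hω, repr_intCast_add_intCast_mul_one b hb, repr_intCast_add_intCast_mul_zero b hb]

include hb hω hD hs in
/-- Every class of `C(O_D)` is the class of a primitive positive-definite form whose leading coefficient is
prime to `c` (Thm. 7.7 (ii) surjectivity, `existsUnique_isReduced_classOf'_eq`, followed by Cox's Lemma 2.25: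
a form properly represents integers prime to any given `M`). [cite: Cox2013, §7.B Thm. 7.7 (ii), p. 137]
[cite: Cox2013, §2.C Lemma 2.25, p. 35] -/
theorem exists_isCoprime_classOf'_eq (h2 : finrank ℚ K = 2) [IsCMField K] (hc : c ≠ 0)
    (x : ClassGroup (QO Δ)) :
    ∃ q : BinQF, q.IsPosPrim Δ.D ∧ IsCoprime q.a (c : ℤ) ∧ classOf' Δ q = x := by
  obtain ⟨g, ⟨hg, -, hgx⟩, -⟩ := (CMTypeLattice.existsUnique_isReduced_classOf'_eq h2 b hb hω hD hs hc).1 x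
  obtain ⟨q, hgq, hq, hqa⟩ := exists_properEquiv_isPosPrim_isCoprime_a Δ.neg hg
    (M := (c : ℤ)) (by exact_mod_cast hc)
  refine ⟨q, hq, hqa, ?_⟩
  rw [← hgx, ← classOf'_reduce Δ hg, ← classOf'_reduce Δ hq, (reduce_eq_iff_properEquiv Δ.neg hg hq).2 hgq]

include hb hω hD hs hι in
/-- **THE BRIDGE (Cox, Thm. 7.7 (ii) across the tree's two currencies).** For `K` imaginary quadratic with
integral basis `(1, ω)`, `ω² = m + tω`, conductor `c ≥ 1`, `D = Δ.D = c²(t² + 4m) = c²d_K`, the embedding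
`ι : O_D → 𝓞_K` (`ω_D ↦ cω + s`) and its co-restriction `φ : O_D → 𝒪_c = quadOrder K c` (`(φ z : K) = ι z`,
`exists_ringHom_quadOrder`), there is a group isomorphism
`e : C(O_D) = ClassGroup (QO Δ) ≃* Pic(𝒪_c) = ClassGroup (quadOrder K c)` with **`e [𝔞] = [φ(𝔞)]`** for every
invertible ideal `𝔞 ⊆ O_D` — i.e. `e (ClassGroup.mk _ I) = ClassGroup.mk K u` whenever `(I : FractionalIdeal) = 𝔞`
and `(u : FractionalIdeal) = φ(𝔞)`. It is Mathlib's `ClassGroup.extendedHom` along `φ`; injective by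
Prop. 7.22 (`RingClassForms.properEquiv_of_mk_eq` through §2), onto by `|C(O_D)| = h(D) = |Pic(𝒪_c)|`.
[cite: Cox2013, §7.B Thm. 7.7 (ii), pp. 137–138] [cite: Cox2013, §7.C Prop. 7.22, pp. 145–146] -/
theorem exists_formClassEquiv (hK : IsImaginaryQuadratic K) [NeZero c]
    (φ : QO Δ →+* quadOrder K c) (hφ : ∀ z : QO Δ, ((φ z : quadOrder K c) : K) = algebraMap (𝓞 K) K (ι z)) :
    ∃ e : ClassGroup (QO Δ) ≃* ClassGroup (quadOrder K c),
      ∀ (I : (FractionalIdeal (QO Δ)⁰ (Fr Δ))ˣ) (I₀ : Ideal (QO Δ)),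
        (I : FractionalIdeal (QO Δ)⁰ (Fr Δ)) = (I₀ : FractionalIdeal (QO Δ)⁰ (Fr Δ)) →
        ∀ u : (FractionalIdeal (quadOrder K c)⁰ K)ˣ,
          (u : FractionalIdeal (quadOrder K c)⁰ K) =
            (((I₀.map φ : Ideal (quadOrder K c))) : FractionalIdeal (quadOrder K c)⁰ K) →
          e (ClassGroup.mk (Fr Δ) I) = ClassGroup.mk K u := by
  classical
  have h2 : finrank ℚ K = 2 := hK.1
  haveI : IsCMField K := hK.isCMField
  have hc : c ≠ 0 := NeZero.ne c
  have hφinj : Function.Injective φ := ringHom_quadOrder_injective b hb ι hι hc φ hφ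
  letI : Algebra (QO Δ) (quadOrder K c) := φ.toAlgebra
  haveI : Module.IsTorsionFree (QO Δ) (quadOrder K c) := Module.isTorsionFree_iff_algebraMap_injective.2 hφinj
  let e₀ : ClassGroup (QO Δ) →* ClassGroup (quadOrder K c) := ClassGroup.extendedHom (QO Δ) (quadOrder K c)
  -- the formula `e₀ [I] = [φ(I₀)]`, with the target unit produced
  have hunit : ∀ (I : (FractionalIdeal (QO Δ)⁰ (Fr Δ))ˣ) (I₀ : Ideal (QO Δ)),
      (I : FractionalIdeal (QO Δ)⁰ (Fr Δ)) = (I₀ : FractionalIdeal (QO Δ)⁰ (Fr Δ)) →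
      ∃ u : (FractionalIdeal (quadOrder K c)⁰ K)ˣ,
        (u : FractionalIdeal (quadOrder K c)⁰ K) =
          (((I₀.map φ : Ideal (quadOrder K c))) : FractionalIdeal (quadOrder K c)⁰ K) ∧
        e₀ (ClassGroup.mk (Fr Δ) I) = ClassGroup.mk K u := by
    intro I I₀ hI
    obtain ⟨u, hu, he⟩ := exists_extendedHom_mk_eq_mk (B := quadOrder K c) (L := K) I I₀ hI
    exact ⟨u, by rw [hu, RingHom.algebraMap_toAlgebra], he⟩
  have he₀ : ∀ (I : (FractionalIdeal (QO Δ)⁰ (Fr Δ))ˣ) (I₀ : Ideal (QO Δ)),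
      (I : FractionalIdeal (QO Δ)⁰ (Fr Δ)) = (I₀ : FractionalIdeal (QO Δ)⁰ (Fr Δ)) →
      ∀ u : (FractionalIdeal (quadOrder K c)⁰ K)ˣ,
        (u : FractionalIdeal (quadOrder K c)⁰ K) =
          (((I₀.map φ : Ideal (quadOrder K c))) : FractionalIdeal (quadOrder K c)⁰ K) →
        e₀ (ClassGroup.mk (Fr Δ) I) = ClassGroup.mk K u := by
    intro I I₀ hI u hu
    obtain ⟨u', hu', he⟩ := hunit I I₀ hI
    rw [he, show u' = u from Units.ext (hu'.trans hu.symm)]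
  -- on form classes, followed by `picardRingClassEquiv`: the class `[𝔞_q𝓞_K]` of `RingClassForms`
  have hform : ∀ {q : BinQF} (hq : q.IsPosPrim Δ.D) (hqa : IsCoprime q.a (c : ℤ)),
      picardRingClassEquiv hK c (e₀ (classOf' Δ q)) =
        (QuotientGroup.mk ⟨_, mk0_map_fIdeal_mem ι hq hqa⟩ : RingClassGroup K c) := by
    intro q hq hqa
    obtain ⟨u, hu, he⟩ := hunit (fUnit Δ hq) (fIdeal Δ q) (val_fUnit Δ hq)
    rw [classOf'_eq Δ hq, he]
    exact picardRingClassEquiv_mk_of_coe_eq_map_fIdeal ι hK φ hφ hq hqa u hu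
  -- injectivity (Prop. 7.22 through `RingClassForms`)
  have hinj : Function.Injective e₀ := by
    intro x y hxy
    obtain ⟨q₁, h₁, ha₁, rfl⟩ := exists_isCoprime_classOf'_eq b hb hω hD hs h2 hc x
    obtain ⟨q₂, h₂, ha₂, rfl⟩ := exists_isCoprime_classOf'_eq b hb hω hD hs h2 hc y
    have heq := congrArg (picardRingClassEquiv hK c) hxy
    rw [hform h₁ ha₁, hform h₂ ha₂] at heq
    have hpe : q₁.ProperEquiv q₂ := properEquiv_of_mk_eq b hb ι hι hc h₁ h₂ ha₁ ha₂ heq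
    rw [← classOf'_reduce Δ h₁, ← classOf'_reduce Δ h₂, (reduce_eq_iff_properEquiv Δ.neg h₁ h₂).2 hpe]
  -- bijectivity by counting
  haveI : Finite (ClassGroup (quadOrder K c)) := finite_classGroup c
  have hcard : Nat.card (ClassGroup (quadOrder K c)) ≤ Nat.card (ClassGroup (QO Δ)) := by
    rw [natCard_classGroup_quadOrder_eq_classNumber hK c,
      CMTypeLattice.natCard_classGroup_QO_eq_classNumber' b hb hω h2 hD hs hc, hD,
      discr_eq_of_basis b hb hω]
  have hbij : Function.Bijective e₀ := hinj.bijective_of_nat_card_le hcard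
  exact ⟨MulEquiv.ofBijective e₀ hbij, fun I I₀ hI u hu => by
    rw [MulEquiv.ofBijective_apply]; exact he₀ I I₀ hI u hu⟩

include hb hω hD hs hι in
/-- **THE BRIDGE ON FORM CLASSES**: with `e` as in `exists_formClassEquiv`,
**`e (classOf' Δ q) = [𝔟_q]`**, `𝔟_q = φ(𝔞_q) = (a_q, φ(ω_D − k(q)))` — Cox's «`f(x,y) ↦ [a, (−b + √D)/2]`» read in
`𝒪_c ⊂ K` — for EVERY primitive positive-definite `q` of discriminant `D`; and, when `gcd(a_q, c) = 1`,
**`picardRingClassEquiv hK c (e (classOf' Δ q)) = [𝔞_q𝓞_K]`** (the class of `RingClassForms`, so that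
`mk_eq_of_properEquiv`, `properEquiv_of_mk_eq`, `exists_form_mk_eq` apply to `e`).
[cite: Cox2013, §7.B Thm. 7.7 (ii), pp. 137–138] [cite: Cox2013, §7.C Prop. 7.22, pp. 145–146] -/
theorem exists_formClassEquiv_classOf' (hK : IsImaginaryQuadratic K) [NeZero c]
    (φ : QO Δ →+* quadOrder K c) (hφ : ∀ z : QO Δ, ((φ z : quadOrder K c) : K) = algebraMap (𝓞 K) K (ι z)) :
    ∃ e : ClassGroup (QO Δ) ≃* ClassGroup (quadOrder K c),
      (∀ (q : BinQF), q.IsPosPrim Δ.D → ∀ u : (FractionalIdeal (quadOrder K c)⁰ K)ˣ,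
          (u : FractionalIdeal (quadOrder K c)⁰ K) =
            (((fIdeal Δ q).map φ : Ideal (quadOrder K c)) : FractionalIdeal (quadOrder K c)⁰ K) →
          e (classOf' Δ q) = ClassGroup.mk K u) ∧
      (∀ (q : BinQF) (hq : q.IsPosPrim Δ.D) (hqa : IsCoprime q.a (c : ℤ)),
          picardRingClassEquiv hK c (e (classOf' Δ q)) =
            (QuotientGroup.mk ⟨_, mk0_map_fIdeal_mem ι hq hqa⟩ : RingClassGroup K c)) := by
  obtain ⟨e, he⟩ := exists_formClassEquiv b hb hω hD hs ι hι hK φ hφ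
  have hval : ∀ {q : BinQF} (hq : q.IsPosPrim Δ.D) (u : (FractionalIdeal (quadOrder K c)⁰ K)ˣ),
      (u : FractionalIdeal (quadOrder K c)⁰ K) =
        (((fIdeal Δ q).map φ : Ideal (quadOrder K c)) : FractionalIdeal (quadOrder K c)⁰ K) →
      e (classOf' Δ q) = ClassGroup.mk K u := fun hq u hu => by
    rw [classOf'_eq Δ hq]
    exact he _ _ (val_fUnit Δ hq) u hu
  refine ⟨e, fun q hq u hu => hval hq u hu, fun q hq hqa => ?_⟩
  -- a unit with value `φ(𝔞_q)`: invertibility is transported by `e` itself (take its value on `[𝔞_q]`)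
  classical
  have h2 : finrank ℚ K = 2 := hK.1
  haveI : IsCMField K := hK.isCMField
  have hc : c ≠ 0 := NeZero.ne c
  letI : Algebra (QO Δ) (quadOrder K c) := φ.toAlgebra
  haveI : Module.IsTorsionFree (QO Δ) (quadOrder K c) :=
    Module.isTorsionFree_iff_algebraMap_injective.2 (ringHom_quadOrder_injective b hb ι hι hc φ hφ)
  obtain ⟨u, hu, -⟩ :=
    exists_extendedHom_mk_eq_mk (B := quadOrder K c) (L := K) (fUnit Δ hq) (fIdeal Δ q) (val_fUnit Δ hq)
  rw [RingHom.algebraMap_toAlgebra] at hu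
  rw [hval hq u hu]
  exact picardRingClassEquiv_mk_of_coe_eq_map_fIdeal ι hK φ hφ hq hqa u hu

/-- **THE BRIDGE from `K` and `D = c²d_K` alone** (all the data of the `RingClass` series produced, not
supplied): for `K` imaginary quadratic, `c ≥ 1` and `Δ.D = c²d_K` there are an integral basis `b = (1, ω)` of
`𝓞_K`, the shift `s`, the embedding `ι : O_D → 𝓞_K` (`ω_D ↦ cω + s`), its bijective co-restriction
`φ : O_D → 𝒪_c` and the isomorphism `e : C(O_D) ≃* Pic(𝒪_c)` of `exists_formClassEquiv_classOf'` with both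
formulas. (Which square root `2ω − t` of `d_K` the basis picks is left unspecified here; a consumer that needs
a specific one supplies its own basis to `exists_formClassEquiv_classOf'`.)
[cite: Cox2013, §7.B Thm. 7.7 (ii), pp. 137–138] [cite: Cox2013, §7.C Prop. 7.22, pp. 145–146] -/
theorem exists_formClassEquiv_of_discr_eq (hK : IsImaginaryQuadratic K) [NeZero c]
    (hΔ : Δ.D = (c : ℤ) ^ 2 * NumberField.discr K) :
    ∃ (b : Basis (Fin 2) ℤ (𝓞 K)) (_ : b 0 = 1) (s : ℤ) (ι : QO Δ →+* 𝓞 K)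
      (_ : ι ω = (c : 𝓞 K) * b 1 + (s : 𝓞 K)) (φ : QO Δ →+* quadOrder K c)
      (e : ClassGroup (QO Δ) ≃* ClassGroup (quadOrder K c)),
      Function.Bijective φ ∧ (∀ z : QO Δ, ((φ z : quadOrder K c) : K) = algebraMap (𝓞 K) K (ι z)) ∧
      (∀ (q : BinQF), q.IsPosPrim Δ.D → ∀ u : (FractionalIdeal (quadOrder K c)⁰ K)ˣ,
          (u : FractionalIdeal (quadOrder K c)⁰ K) =
            (((fIdeal Δ q).map φ : Ideal (quadOrder K c)) : FractionalIdeal (quadOrder K c)⁰ K) →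
          e (classOf' Δ q) = ClassGroup.mk K u) ∧
      (∀ (q : BinQF) (hq : q.IsPosPrim Δ.D) (hqa : IsCoprime q.a (c : ℤ)),
          picardRingClassEquiv hK c (e (classOf' Δ q)) =
            (QuotientGroup.mk ⟨_, mk0_map_fIdeal_mem ι hq hqa⟩ : RingClassGroup K c)) := by
  have h2 : finrank ℚ K = 2 := hK.1
  have hc : c ≠ 0 := NeZero.ne c
  obtain ⟨b, hb⟩ := exists_basis_zero_eq_one h2
  have hω := basis_one_mul_self_eq b hb
  have hD : Δ.D = (c : ℤ) ^ 2 * ((b.repr (b 1 * b 1) 1) ^ 2 + 4 * b.repr (b 1 * b 1) 0) := by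
    rw [hΔ, discr_eq_sq_add_four_mul b hb]
  obtain ⟨s, hs'⟩ := two_dvd_sub hD
  have hs : 2 * s = Δ.D - c * b.repr (b 1 * b 1) 1 := by linarith
  obtain ⟨ι, hι⟩ := exists_ringHom b hω hD hs
  obtain ⟨φ, hφbij, hφ⟩ := exists_ringHom_quadOrder b hb ι hι hc
  obtain ⟨e, hea, heb⟩ := exists_formClassEquiv_classOf' b hb hω hD hs ι hι hK φ hφ
  exact ⟨b, hb, s, ι, hι, φ, e, hφbij, hφ, hea, heb⟩

include hb hω hD hs in
/-- **Uniqueness**: an isomorphism (indeed any map) `C(O_D) → Pic(𝒪_c)` is determined by its values on the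
form classes `classOf' Δ q`, `gcd(a_q, c) = 1` (every class is such a class, `exists_isCoprime_classOf'_eq`);
hence the `e` of `exists_formClassEquiv_classOf'` is unique. [cite: Cox2013, §7.B Thm. 7.7 (ii), p. 137] -/
theorem formClassEquiv_unique (h2 : finrank ℚ K = 2) [IsCMField K] (hc : c ≠ 0)
    {e e' : ClassGroup (QO Δ) → ClassGroup (quadOrder K c)}
    (h : ∀ q : BinQF, q.IsPosPrim Δ.D → IsCoprime q.a (c : ℤ) → e (classOf' Δ q) = e' (classOf' Δ q)) :
    e = e' := by
  funext x
  obtain ⟨q, hq, hqa, rfl⟩ := exists_isCoprime_classOf'_eq b hb hω hD hs h2 hc x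
  exact h q hq hqa

end QuadOrderTower

end Literature.NumberTheory.EllipticCurves

end
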